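import Summits.BirchSwinnertonDyer.Rank1Residual.Additive.DefectCountSignedTwistAssembly
import Summits.BirchSwinnertonDyer.Rank1Residual.Additive.DefectCountLevelInputs
import Summits.BirchSwinnertonDyer.Rank1Residual.Additive.StrictSignedDualFiniteTorsion
import Summits.BirchSwinnertonDyer.Rank1Residual.Additive.TowerStructureLocalIndex
import Summits.BirchSwinnertonDyer.Rank1Residual.Additive.StrictSignedSelmerLayerZero
import HarnessLib

/-!
# `f(0) · #X[T] = u · #A₀` WITHOUT the no-finite-submodule input, and the level-`p^m` count
# **`#Sel^{loc,∞}(W/ℚ) = #Sel_str(W/ℚ)[p^∞] · p^ν · ∏_{ℓ ∈ T} p^{ord_p c_ℓ(W)}`** with NO dual datum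
# (cell `b2b-bsdres`, CLASS-CLOSURE lane, class O10 — x1b GEN 44, class lead; file 120 of the series;
# consumer: file 121 `ShaCardSignedTwistRankOneDefect.lean`, the `hnf`-free Selmer side of (C3_η))

HONEST FRAMING (cell `b2b-bsdres`, run/shared/lean/b2b/bsd-rank1-residual/, verbatim in every
file): the goal of the cell is to DELETE the COMBINATION-SHAPED residual classes of the
Birch–Swinnerton-Dyer formula for ALL analytic-rank `≤ 1` elliptic curves over `ℚ` — "full BSD
formula for every rank `≤ 1` curve in class `C`" assembled STRICTLY from published theorems — so
that the rank-`≤ 1` remainder becomes exactly the CONSTRUCTION-SHAPED classes, which are TYPED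
(missing-input `Prop`s), NOT attempted. This is not "finishing BSD". CLASS-CLOSURE lane: prove
what is provable now; shrink each hard class to its core with data; no claim beyond stated classes;
research routes on CONSTRUCTION-SHAPED X12 / O10; census / instrument output = EVIDENCE / conjecture
items, NEVER a Literature fact; `RESIDUAL-MAP.md` marks change only by signed lines. THIS FILE:
TOOL THEOREMS ONLY — no definition, no named Literature fact, no Summits-side fact `def … : Prop`,
no `sorry`, axioms standard; §2 is CONDITIONAL (hypothesis `hPT`) on the NAMED FACT
`poitouTate_selmerStructure_duality_real ℚ` exactly as file 107; NOTHING here assumes the absence of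
finite `Λ`-submodules (`hnf`). Nothing is booked; no label / mark / count / sub-cell moves; nothing
about (C1_η), (C2_η-GZ), (C3_η) as typed, or `BSD(W, p)` of any pair, is claimed.

## What

* §1 (any number field `K`, any `ℤ_p`-extension `κ` with topological generator `γ`, any elliptic `E/K`
  with `E(K_∞)[p^∞] = 0`, ANY `conj_γ`-stable family `S_∞ ≤ H¹(K_∞, E[p^∞])` with a Pontryagin-dual
  pair `(S_∞, conj_γ − 1) ↔ X`, `X` f.g. torsion, `char(X) = (f)`)
  `SubSelmerControlZero.natCard_comap_eq_and_constantCoeff_mul_natCard_invariants_eq`: if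
  `A₀ = h₀⁻¹(S_∞)` is FINITE then `#A₀ = #(X/TX)` (`h₀ : A₀ ≅ S_∞^γ`, [K] Lemma 9.1 + Greenberg Lemma
  3.2), `#X[T] = #(S_∞)_γ` is a power of `p`, and **`f(0) · #X[T] = u · #A₀`**, `u ∈ ℤ_pˣ` (Greenberg's
  Lemma 4.2, `X`-side: the tree's `IwasawaAlgebra.constantCoeff_charGenerator_mul_natCard_invariants`) —
  file 42's `ord_p #S₀ + ord_p #(A₀/S₀) = ord_p f(0)` had `hnf` to kill `X[T]`; here `X[T]` is KEPT.
  Instances: the strict signed structure (`StrictSignedControlZero.…`) and the `p*`-twist with (hB), B2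
  discharged (`…_of_quadraticTwist_signedPrime`, files 55 / 49).
* §2 (level `p^m`, NO dual datum, NO `Λ`-module) `LevelBridge.card_localPreimage_eq_mul_of_quadraticTwist_signedPrime`:
  for the `p*`-twist `W` of a globally minimal good `a_p = 0` curve:
  **`#Sel^{loc,∞}(W/ℚ) = #Sel_str(W/ℚ)[p^∞] · (p^ν · ∏_{ℓ ∈ T} p^{ord_p c_ℓ(W)})`** given `#A₀ ∣ p^a` and
  the level-`m` inputs of file 107 — the count (C) of file 107 (`[A₀ : S₀] = p^ν · ∏_ℓ [𝓣_ℓ : 𝓚_ℓ]`),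
  file 75 (`[𝓣_ℓ : 𝓚_ℓ] = p^{ord_p c_ℓ}`), Lagrange and `#S₀ = #Sel_str(W/ℚ)[p^∞]`; i.e. file 108 §1 with
  `ord_p f(0)` replaced by the size exponent `a`.

References: [GreenbergLNM1716] §3 Lemma 3.1–3.3 (pp. 85–90), §4 Thm. 4.1 and Lemma 4.2 (p. 102);
[Kobayashi2003] Def. 2.1 (p. 5), Thm. 6.2 (p. 11), Lemma 9.1 (p. 25), Thm. 9.3 (p. 26); [MilneADT2006]
I Thm. 2.8, Lemma 3.3, Thm. 4.10; [CoatesSchneiderSujatha2003] §3 (30)–(31).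
-/

noncomputable section

open scoped Classical

open CategoryTheory Field Function NumberField IsDedekindDomain WeierstrassCurve
open Literature.NumberTheory.EllipticCurves
open Literature.NumberTheory.GaloisRepresentations
open Literature.NumberTheory.GaloisRepresentations.DiscreteGaloisModule (SelmerStructure)
open Literature.NumberTheory.GaloisCohomology
open Literature.NumberTheory.EllipticCurves.Kobayashi2003
open Literature.NumberTheory.EllipticCurves.IwasawaAlgebra
open Literature.NumberTheory.EllipticCurves.IwasawaDual
open Summit.BirchSwinnertonDyer.Rank1Residual.X11b.Levels
open Summit.BirchSwinnertonDyer.Rank1Residual.X11b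
open scoped ContRepresentation

universe u

namespace Summit.BirchSwinnertonDyer.Rank1Residual.Additive

/-! ## §1 `f(0) · #X[T] = u · #A₀` for a sub-Selmer family with `A₀` finite — NO `hnf` -/

namespace SubSelmerControlZero

section Selmer

variable {K : Type u} [Field K] [NumberField K] (W : WeierstrassCurve K) {p : ℕ} [Fact p.Prime]
  {κ : ZpExtension K p} {γ : Field.absoluteGaloisGroup K}

/-- **Greenberg's Lemma 4.2 for a sub-Selmer family, `hnf`-FREE.** Let `E/K` be an elliptic curve
over a number field, `κ` a `ℤ_p`-extension with topological generator `γ`, `S_∞ ≤ H¹(K_∞, E[p^∞])`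
ANY subgroup with an endomorphism `ψ` acting as `conj_γ − 1`, `(S_∞, ψ) ↔ X` a Pontryagin-dual pair
with `X` finitely generated `Λ`-torsion and `char(X) = (f)`, `E(K_∞)[p^∞] = 0`, and suppose
`A₀ = h₀⁻¹(S_∞)` is FINITE. Then `#A₀ = #(X/TX)` (`h₀ : A₀ ≅ S_∞^{ψ=0}` is a bijection — [K] Lemma 9.1
for injectivity, Greenberg's Lemma 3.2 for surjectivity — and `#(X/TX) = #S_∞^{ψ=0}`), `#X[T]` is a
power of `p` (`#X[T] = #(S_∞)_ψ`, a quotient of the `p`-primary `S_∞`), and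
**`f(0) · #X[T] = u · #A₀` for a unit `u ∈ ℤ_pˣ`** (Lemma 4.2, `X`-side). The finite group `X[T]` is
the EXACT defect by which `#A₀` exceeds `p^{ord_p f(0)}`; it vanishes when `X` has no non-trivial
finite `Λ`-submodule (the `hnf` of file 42), which is NOT assumed here.
[cite: GreenbergLNM1716, §3 Lemma 3.1–3.2 (p. 86) and §4 Lemma 4.2 (p. 102)]
[cite: Kobayashi2003, Lemma 9.1 (p. 25)] [cite: CoatesSchneiderSujatha2003, §3 (30)–(31)] -/
theorem natCard_comap_eq_and_constantCoeff_mul_natCard_invariants_eq (hγ : κ.IsTopGenerator γ)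
    (hB : FixedPoints.addSubgroup κ.kerSubgroup (W.geomPrimaryTorsion p) = ⊥)
    {Sinf : AddSubgroup (W.subgroupH1 p κ.kerSubgroup)} {ψ : AddMonoid.End Sinf}
    (hψ : ∀ s : Sinf, ((ψ s : Sinf) : W.subgroupH1 p κ.kerSubgroup) =
      W.conjH1 p κ.kerSubgroup γ (s : W.subgroupH1 p κ.kerSubgroup) - s)
    {X : Type u} [AddCommGroup X] [Module (IwasawaAlgebra p) X] [Module.Finite (IwasawaAlgebra p) X]
    {toDual : X →+ (Sinf →+ AddCircle (1 : ℚ))} (hpair : IsDualPair p ψ toDual)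
    (hX : Module.IsTorsion (IwasawaAlgebra p) X)
    {f : IwasawaAlgebra p} (hf : Module.charIdeal (IwasawaAlgebra p) X = Ideal.span {f})
    [hfin : Finite (Sinf.comap (W.layerToInfty κ 0))] :
    Nat.card (Sinf.comap (W.layerToInfty κ 0)) = Nat.card (coinvariants p X) ∧
      (∃ b : ℕ, Nat.card (invariants p X) = p ^ b) ∧
      ∃ u : ℤ_[p]ˣ, PowerSeries.constantCoeff f * (Nat.card (invariants p X) : ℤ_[p]) =
        u * Nat.card (Sinf.comap (W.layerToInfty κ 0)) := by
  set A₀ := Sinf.comap (W.layerToInfty κ 0) with hA₀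
  -- `A₀ → S_∞^{ψ=0}`, `y ↦ h₀ y`: a bijection (as in file 42)
  have hmemS : ∀ y : A₀, W.layerToInfty κ 0 (y : W.subgroupH1 p (κ.layerSubgroup 0)) ∈ Sinf :=
    fun y ↦ AddSubgroup.mem_comap.mp y.2
  have hfix : ∀ y : A₀, (⟨W.layerToInfty κ 0 (y : W.subgroupH1 p (κ.layerSubgroup 0)), hmemS y⟩ : Sinf) ∈
      endInvariants ψ := by
    intro y
    rw [mem_endInvariants_iff]
    apply Subtype.ext
    rw [hψ, ZeroMemClass.coe_zero, sub_eq_zero]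
    have hinv := W.range_layerToInfty_le_layerInvariants_holds κ 0
      ⟨(y : W.subgroupH1 p (κ.layerSubgroup 0)), rfl⟩
    rw [mem_layerInvariants_iff] at hinv
    exact hinv γ (by rw [ZpExtension.layerSubgroup_zero]; exact Subgroup.mem_top γ)
  let Φ : A₀ → endInvariants ψ := fun y ↦
    ⟨⟨W.layerToInfty κ 0 (y : W.subgroupH1 p (κ.layerSubgroup 0)), hmemS y⟩, hfix y⟩
  have hΦinj : Function.Injective Φ := fun a b hab ↦ by
    have h := congrArg (fun z : endInvariants ψ ↦ ((z : Sinf) : W.subgroupH1 p κ.kerSubgroup)) hab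
    exact Subtype.ext (SignedControlZero.layerToInfty_zero_injective W hγ hB h)
  have hΦsurj : Function.Surjective Φ := by
    rintro ⟨s, hs⟩
    obtain ⟨y, hyA, hy⟩ := exists_layerToInfty_eq_of_mem_endInvariants W hγ hψ hs
    exact ⟨⟨y, hyA⟩, Subtype.ext (Subtype.ext hy)⟩
  have hcardA : Nat.card A₀ = Nat.card (endInvariants ψ) := Nat.card_eq_of_bijective Φ ⟨hΦinj, hΦsurj⟩
  haveI hfinE : Finite (endInvariants ψ) := Finite.of_surjective Φ hΦsurj
  have hfinco : Finite (coinvariants p X) := hpair.finite_coinvariants_iff.mpr hfinE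
  have hco : Nat.card (coinvariants p X) = Nat.card (endInvariants ψ) := hpair.natCard_coinvariants
  -- `#X[T] = #(S_∞)_ψ` is a power of `p`
  haveI hfinI : Finite (invariants p X) := (finite_invariants_iff_finite_coinvariants p X hX).mpr hfinco
  haveI hfinC : Finite (EndCoinvariants ψ) := hpair.finite_invariants_iff.mp hfinI
  have hprimS : ∀ s : Sinf, ∃ k : ℕ, p ^ k • s = 0 := fun s ↦ by
    obtain ⟨k, hk⟩ := W.exists_pow_smul_subgroupH1_ker_eq_zero κ (s : W.subgroupH1 p κ.kerSubgroup)
    exact ⟨k, Subtype.ext (by rw [AddSubgroupClass.coe_nsmul, hk, ZeroMemClass.coe_zero])⟩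
  have hpow : ∃ b : ℕ, Nat.card (EndCoinvariants ψ) = p ^ b := by
    have hG : IsPGroup p (Multiplicative (EndCoinvariants ψ)) := fun x ↦ by
      induction x using QuotientAddGroup.induction_on with
      | H s =>
        obtain ⟨k, hk⟩ := hprimS s
        refine ⟨k, ?_⟩
        apply Multiplicative.toAdd.injective
        rw [toAdd_pow, toAdd_one]
        change QuotientAddGroup.mk (p ^ k • s) = _
        rw [hk, QuotientAddGroup.mk_zero]
    obtain ⟨b, hb⟩ := IsPGroup.iff_card.mp hG
    exact ⟨b, by rw [← hb]; exact (Nat.card_congr Multiplicative.toAdd).symm⟩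
  obtain ⟨b, hb⟩ := hpow
  obtain ⟨u, hu⟩ := constantCoeff_charGenerator_mul_natCard_invariants p X hX f hf hfinco
  refine ⟨hcardA.trans hco.symm, ⟨b, by rw [hpair.natCard_invariants, hb]⟩, u, ?_⟩
  rw [hu, hco, hcardA]

end Selmer

end SubSelmerControlZero

namespace StrictSignedControlZero

section General

variable {K : Type u} [Field K] [NumberField K] (W : WeierstrassCurve K) {p : ℕ} [Fact p.Prime]
  (κ : ZpExtension K p) (E : Type u) [Field E] [Algebra K E] (ε : ℤˣ)

/-- **`f(0) · #X^{ε,str}[T] = u · #A₀`, `hnf`-FREE, for Kobayashi's STRICT signed structure in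
`W`-coordinates** (`D : StrictSignedSelmerDualData W κ E γ ε` with `X` f.g. torsion, `char = (f)`;
`E(K_∞)[p^∞] = 0`; `A₀ = h₀⁻¹(Sel^{ε,str}(E/K_∞))` FINITE): `#A₀ = #(X/TX)`, `#X[T] = p^b`, and
`f(0)·#X[T] = u·#A₀` — §1 at `S_∞ = Sel^{ε,str}_∞` (`StrictSignedSelmerDual.isDualPair`).
[cite: GreenbergLNM1716, §4 Lemma 4.2 (p. 102)] [cite: Kobayashi2003, Lemma 9.1 (p. 25), Def. 2.1 (p. 5)] -/
theorem natCard_comap_eq_and_constantCoeff_mul_natCard_invariants_eq {γ : Field.absoluteGaloisGroup K}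
    (hγ : κ.IsTopGenerator γ) (D : StrictSignedSelmerDualData W κ E γ ε)
    [Module.Finite (IwasawaAlgebra p) D.X] (hX : Module.IsTorsion (IwasawaAlgebra p) D.X)
    (hB : FixedPoints.addSubgroup κ.kerSubgroup (W.geomPrimaryTorsion p) = ⊥)
    {f : IwasawaAlgebra p} (hf : D.charIdeal = Ideal.span {f})
    [Finite ((strictSignedSelmerInfty W κ E ε).comap (W.layerToInfty κ 0))] :
    Nat.card ((strictSignedSelmerInfty W κ E ε).comap (W.layerToInfty κ 0)) = Nat.card (coinvariants p D.X) ∧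
      (∃ b : ℕ, Nat.card (invariants p D.X) = p ^ b) ∧
      ∃ u : ℤ_[p]ˣ, PowerSeries.constantCoeff f * (Nat.card (invariants p D.X) : ℤ_[p]) =
        u * Nat.card ((strictSignedSelmerInfty W κ E ε).comap (W.layerToInfty κ 0)) :=
  SubSelmerControlZero.natCard_comap_eq_and_constantCoeff_mul_natCard_invariants_eq W hγ hB
    (coe_conjStrictSignedSelmerInfty_sub_one_apply W κ E ε γ) (isDualPair D hγ) hX hf

end General

section Twist

variable {p : ℕ} [hp : Fact p.Prime] (κ : ZpExtension ℚ p) (W : WeierstrassCurve ℚ) [W.IsElliptic]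
  (ε : ℤˣ)

/-- **`f(0) · #X[T] = u · #Sel^{loc,∞}(W/ℚ)` for the `p*`-TWIST `W` of a globally minimal good
`a_p = 0` curve `V`** (`C • W.quadraticTwist ((−1)^{p/2} p) = V`, `p ≥ 3`), `hnf`-FREE: for every strict
signed dual datum `D` (model `ℚ_[p]`, sign `ε`) with `X` f.g. torsion and `char = (f)`, provided
`Sel^{loc,∞}(W/ℚ)` (B2 form: classes over `ℚ` restricting into `Sel_{p^∞}(W/ℚ_∞)` and into the strict
signed Kummer condition at every conjugate of the embedding at `p`) is finite:
`#Sel^{loc,∞}(W/ℚ) = #(X/TX)`, `#X[T] = p^b`, and **`f(0) · #X[T] = u · #Sel^{loc,∞}(W/ℚ)`** — §1 with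
(hB) and B2 discharged by file 55 / file 49. [cite: GreenbergLNM1716, §4 Lemma 4.2 (p. 102)]
[cite: Kobayashi2003, Prop. 8.7 (p. 16), Lemma 9.1 (p. 25), Thm. 9.3 (p. 26)] -/
theorem constantCoeff_mul_natCard_invariants_eq_of_quadraticTwist_signedPrime (hp2 : p ≠ 2)
    (C : VariableChange ℚ) (V : WeierstrassCurve ℚ) [V.IsElliptic] [V.IsGloballyMinimal]
    (hCV : C • W.quadraticTwist ((-1) ^ (p / 2) * p) = V)
    (hgood : V.HasGoodReductionAtPrime p) (hap : V.frobeniusTrace p = 0)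
    {γ : Field.absoluteGaloisGroup ℚ} (hγ : κ.IsTopGenerator γ)
    (D : StrictSignedSelmerDualData W κ ℚ_[p] γ ε)
    [Module.Finite (IwasawaAlgebra p) D.X] (hX : Module.IsTorsion (IwasawaAlgebra p) D.X)
    {f : IwasawaAlgebra p} (hf : D.charIdeal = Ideal.span {f})
    [hfin : Finite (↥((W.selmerInfty κ ⊓
          ⨅ σ : Field.absoluteGaloisGroup ℚ,
            (localKummerOverOfEmb W p κ.kerSubgroup (closureEmb (K := ℚ) ℚ_[p])
                (⨆ m, strictSignedLocalPoints κ ℚ_[p] W ε m)).comap (W.conjH1 p κ.kerSubgroup σ)).comap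
          (W.layerToInfty κ 0)))] :
    Nat.card (↥((W.selmerInfty κ ⊓
          ⨅ σ : Field.absoluteGaloisGroup ℚ,
            (localKummerOverOfEmb W p κ.kerSubgroup (closureEmb (K := ℚ) ℚ_[p])
                (⨆ m, strictSignedLocalPoints κ ℚ_[p] W ε m)).comap (W.conjH1 p κ.kerSubgroup σ)).comap
          (W.layerToInfty κ 0))) = Nat.card (coinvariants p D.X) ∧
      (∃ b : ℕ, Nat.card (invariants p D.X) = p ^ b) ∧
      ∃ u : ℤ_[p]ˣ, PowerSeries.constantCoeff f * (Nat.card (invariants p D.X) : ℤ_[p]) =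
        u * Nat.card (↥((W.selmerInfty κ ⊓
          ⨅ σ : Field.absoluteGaloisGroup ℚ,
            (localKummerOverOfEmb W p κ.kerSubgroup (closureEmb (K := ℚ) ℚ_[p])
                (⨆ m, strictSignedLocalPoints κ ℚ_[p] W ε m)).comap (W.conjH1 p κ.kerSubgroup σ)).comap
          (W.layerToInfty κ 0))) := by
  obtain ⟨M, hΔ, hA, hVM⟩ := exists_goodSupersingularPadicModel hp2 V hgood hap
  obtain ⟨S, hS⟩ := exists_finset_forall_not_mem_good W p
  have hc := sq_ne_neg_one_pow_mul_prime hp.out (p / 2)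
  have hB := fixedPoints_kerSubgroup_geomPrimaryTorsion_eq_bot_of_quadraticTwist κ hp2 W hc C hCV M hΔ hA hVM
  have htors := eq_zero_of_prime_pow_smul_eq_zero_localFixedPointsOfEmb_kerSubgroup_of_quadraticTwist κ
    (closureEmb (K := ℚ) ℚ_[p]) hp2 W hc C hCV M hΔ hA hVM
  have hB2 := comap_layerToInfty_zero_strictSignedSelmerInfty_eq W κ ℚ_[p] ε S hS htors
  haveI : Finite ((strictSignedSelmerInfty W κ ℚ_[p] ε).comap (W.layerToInfty κ 0)) := by
    rw [hB2]; exact hfin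
  have h := natCard_comap_eq_and_constantCoeff_mul_natCard_invariants_eq W κ ℚ_[p] ε hγ D hX hB hf
  rw [hB2] at h
  exact h

end Twist

end StrictSignedControlZero

/-! ## §2 Level `p^m`, NO dual datum: `#A₀ = #Sel_str(W/ℚ)[p^∞] · p^ν · ∏_{ℓ ∈ T} p^{ord_p c_ℓ(W)}` -/

-- Over `ℚ` two `ℚ`-algebra structures on a completion are in scope; the general-`K` statements must be
-- met by the completion's own (the device of files 78, 107, 108, 118).
attribute [local instance 10000] IsDedekindDomain.HeightOneSpectrum.instAlgebraAdicCompletion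
  NumberField.Place.instAlgebraCompletion

namespace LevelBridge

variable (W : WeierstrassCurve ℚ) [W.IsElliptic] {p : ℕ} [hp : Fact p.Prime] (κ : ZpExtension ℚ p)
  {m : ℕ} [hint : (W.baseChange ℚ_[p]).IsIntegral ℤ_[p]]

/-- **`#Sel^{loc,∞}(W/ℚ) = #Sel_str(W/ℚ)[p^∞] · (p^ν · ∏_{ℓ ∈ T} p^{ord_p c_ℓ(W)})` at a level `p^m`,
with NO dual datum** — for the `(−1)^{p/2}p`-twist `W` of a globally minimal `V/ℚ` with good reduction at
the odd prime `p` and `a_p(V) = 0` (`W` `p`-integral, `κ` cyclotomic).  The count (C) of file 107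
(`[A₀ : S₀] = p^ν · ∏_ℓ [𝓣_ℓ : 𝓚_ℓ]`, tower structure as an explicit term), file 75
(`[𝓣_ℓ : 𝓚_ℓ] = p^{ord_p c_ℓ}`; no finite place splits in the cyclotomic tower, file 54), Lagrange
(`S₀ ≤ A₀` by B2, file 49, hypothesis-free for the twist by file 55) and `#S₀ = #Sel_str(W/ℚ)[p^∞]`.
CONDITIONAL on exactly: the NAMED FACT `poitouTate_selmerStructure_duality_real ℚ` (`hPT`); the size
bound `#A₀ ∣ p^a` (any `a`; for a finite `A₀` take `#A₀ = p^a`); the exceptional finite set `T ∌ v₀` of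
places `ℓ ∤ p` with `ord_p c_ℓ ≤ m` and `𝒦_{v,0}[p^∞] = 0` off `T ∪ {v₀}`; (MW) `P` generates `W(ℚ)/p^m`
with order `p^m`; (Ш) `Ш[p^m] ⊆ Ш[p^e]`; the exact level `ν` of `P` in `W(ℚ_{v₀})`; (kill)
`p^{m−2ν−e}𝓚_ℓ = 0` (`ℓ ∈ T`); `a + ν + e ≤ m`, `2ν + e ≤ m`, `1 ≤ m`.  File 108 §1 with `ord_p f(0)`
replaced by `a` — no `Λ`-module enters.  Nothing booked. [cite: GreenbergLNM1716, §3 Lemma 3.3 (pp. 86–88), §4 Thm. 4.1]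
[cite: Kobayashi2003, Def. 2.1 (p. 5), Thm. 6.2 (p. 11), Lemma 9.1 (p. 25), Thm. 9.3 (p. 26)]
[cite: MilneADT2006, Ch. I, Thm. 2.8, Lemma 3.3 and Thm. 4.10] -/
theorem card_localPreimage_eq_mul_of_quadraticTwist_signedPrime
    (hm : 1 ≤ m) (hp2 : p ≠ 2) (hκ : κ.IsCyclotomic) (Cv : VariableChange ℚ) (V : WeierstrassCurve ℚ)
    [V.IsElliptic] [V.IsGloballyMinimal] (hCV : Cv • W.quadraticTwist ((-1) ^ (p / 2) * p) = V)
    (hgood : V.HasGoodReductionAtPrime p) (hap : V.frobeniusTrace p = 0)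
    -- the one fact-shaped input: Poitou–Tate duality with the real place
    (hPT : poitouTate_selmerStructure_duality_real ℚ)
    (v₀ : HeightOneSpectrum (𝓞 ℚ)) (hv₀ : (Rat.HeightOneSpectrum.primesEquiv (R := 𝓞 ℚ)).symm ⟨p, hp.out⟩ = v₀)
    -- the size of `A₀`
    {a : ℕ}
    (hA₀card : Nat.card ↥((W.selmerInfty κ ⊓ ⨅ σ : absoluteGaloisGroup ℚ,
        (localKummerOverOfEmb W p κ.kerSubgroup (closureEmb (K := ℚ) ℚ_[p])
          (⨆ n, strictSignedLocalPoints κ ℚ_[p] W (-1) n)).comap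
            (W.conjH1 p κ.kerSubgroup σ)).comap (W.layerToInfty κ 0)) ∣ p ^ a)
    -- the exceptional set
    (T : Finset (HeightOneSpectrum (𝓞 ℚ))) (hv₀T : v₀ ∉ T)
    (hT0 : ∀ v : HeightOneSpectrum (𝓞 ℚ), v ∉ T →
      v ≠ v₀ → W.localTowerKerPrimary κ (v.adicCompletion ℚ) 0 = ⊥)
    (hpT : ∀ w ∈ T, (p : 𝓞 ℚ) ∉ w.asIdeal)
    (hcT : ∀ w ∈ T, padicValNat p ((W.baseChange (w.adicCompletion ℚ)).localTamagawaNumber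
      (w.adicCompletionIntegers ℚ)) ≤ m)
    -- (MW)
    {ν eSha : ℕ} (P : W.toAffine.Point)
    (hgen : ∀ Q : W.toAffine.Point, ∃ a : ℤ,
      Q - a • P ∈ (zsmulAddGroupHom ((p ^ m : ℕ) : ℤ) : W.toAffine.Point →+ _).range)
    (hord : ∀ a : ℤ, a • P ∈ (zsmulAddGroupHom ((p ^ m : ℕ) : ℤ) : W.toAffine.Point →+ _).range →
      ((p ^ m : ℕ) : ℤ) ∣ a)
    -- (Ш)
    (hSha : ∀ c ∈ W.sha, ((p ^ m : ℕ) : ℤ) • c = 0 → p ^ eSha • c = 0)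
    -- (loc): the exact level `ν` of `P` at `v₀`
    {Qv : (W.baseChange (v₀.adicCompletion ℚ)).toAffine.Point}
    (hPQ : p ^ ν • Qv = Affine.Point.baseChange (W' := W) ℚ (v₀.adicCompletion ℚ) P)
    (hexact : ∀ Q' : (W.baseChange (v₀.adicCompletion ℚ)).toAffine.Point,
      p ^ (ν + 1) • Q' ≠ Affine.Point.baseChange (W' := W) ℚ (v₀.adicCompletion ℚ) P)
    -- (kill) at `ℓ ∈ T`
    (hkill : ∀ w ∈ T, ∀ x ∈ W.kummerSelmerStructure ((p ^ m : ℕ) : ℤ) (Sum.inr w),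
      p ^ (m - (ν + eSha) - ν) • x = 0)
    (hnum : a + ν + eSha ≤ m) (hm2 : 2 * ν + eSha ≤ m) :
    Nat.card ↥((W.selmerInfty κ ⊓ ⨅ σ : absoluteGaloisGroup ℚ,
        (localKummerOverOfEmb W p κ.kerSubgroup (closureEmb (K := ℚ) ℚ_[p])
          (⨆ n, strictSignedLocalPoints κ ℚ_[p] W (-1) n)).comap
            (W.conjH1 p κ.kerSubgroup σ)).comap (W.layerToInfty κ 0)) =
      Nat.card ↥(strictSelmerPInfty W p) *
        (p ^ ν * ∏ w ∈ T, p ^ padicValNat p ((W.baseChange (w.adicCompletion ℚ)).localTamagawaNumber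
          (w.adicCompletionIntegers ℚ))) := by
  -- the tower structure `𝓣` on `W[p^m]`, as an explicit term
  let 𝓣 : SelmerStructure (W.torsionGaloisModule ((p ^ m : ℕ) : ℤ)) := fun v ↦
    match v with
    | Sum.inl w => W.kummerSelmerStructure ((p ^ m : ℕ) : ℤ) (Sum.inl w)
    | Sum.inr v => (W.localTowerKer κ (v.adicCompletion ℚ) 0).comap
        ((resH1Hom (Literature.NumberTheory.EllipticCurves.subgroupIncl
            (localSubgroup (κ.layerSubgroup 0) (v.adicCompletion ℚ)))
          (AddMonoidHom.id (localPoints W (v.adicCompletion ℚ))) (fun _ _ ↦ rfl)).comp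
          (galoisCohomology.map
            (W.torsionPointsMapIntertwining ((p ^ m : ℕ) : ℤ) (v.adicCompletion ℚ)) 1))
  have h𝓣fin : ∀ v : HeightOneSpectrum (𝓞 ℚ), 𝓣 (Sum.inr v) =
      (W.localTowerKer κ (v.adicCompletion ℚ) 0).comap
        ((resH1Hom (Literature.NumberTheory.EllipticCurves.subgroupIncl
            (localSubgroup (κ.layerSubgroup 0) (v.adicCompletion ℚ)))
          (AddMonoidHom.id (localPoints W (v.adicCompletion ℚ))) (fun _ _ ↦ rfl)).comp
          (galoisCohomology.map
            (W.torsionPointsMapIntertwining ((p ^ m : ℕ) : ℤ) (v.adicCompletion ℚ)) 1)) := fun _ ↦ rfl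
  have h𝓣inf : ∀ w : InfinitePlace ℚ, 𝓣 (Sum.inl w) = W.kummerSelmerStructure ((p ^ m : ℕ) : ℤ) (Sum.inl w) :=
    fun _ ↦ rfl
  -- the count (C), file 107, with the size bound `#A₀ ∣ p^a`
  have hC := relIndex_strictSignedSelmerLayer_localPreimage_eq_of_quadraticTwist_signedPrime W κ hm hp2 hκ
    Cv V hCV hgood hap hPT v₀ hv₀ T hv₀T 𝓣 h𝓣fin h𝓣inf hT0 hA₀card P hgen hord hSha
    hPQ hexact hkill hnum hm2
  -- the local factors (file 75, B4)
  have hloc : ∀ w ∈ T, (W.kummerSelmerStructure ((p ^ m : ℕ) : ℤ) (Sum.inr w)).relIndex (𝓣 (Sum.inr w)) =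
      p ^ padicValNat p ((W.baseChange (w.adicCompletion ℚ)).localTamagawaNumber
        (w.adicCompletionIntegers ℚ)) := fun w hw ↦ by
    -- no finite place splits completely in the cyclotomic tower (file 54)
    obtain ⟨δ, hδ⟩ := Greenberg1999.exists_apply_resGal_ne_one_of_isCyclotomic hκ w
    exact relIndex_kummer_comap_localTowerKer_eq_pow_padicValNat_localTamagawaNumber W p κ m (hpT w hw)
      ⟨δ, fun h ↦ hδ (ZpExtension.mem_kerSubgroup.mp h)⟩ (hcT w hw)
  rw [Finset.prod_congr rfl hloc] at hC
  -- `S₀ ≤ A₀` (B2, hypothesis-free for the twist: file 55 / file 49)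
  set A := (W.selmerInfty κ ⊓ ⨅ σ : absoluteGaloisGroup ℚ,
      (localKummerOverOfEmb W p κ.kerSubgroup (closureEmb (K := ℚ) ℚ_[p])
        (⨆ n, strictSignedLocalPoints κ ℚ_[p] W (-1) n)).comap
          (W.conjH1 p κ.kerSubgroup σ)).comap (W.layerToInfty κ 0) with hAdef
  set S0 := strictSignedSelmerLayer W κ ℚ_[p] (-1) 0 with hS0
  obtain ⟨M, hΔ, hA, hVM⟩ := exists_goodSupersingularPadicModel hp2 V hgood hap
  obtain ⟨S, hS⟩ := exists_finset_forall_not_mem_good W p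
  have hc := sq_ne_neg_one_pow_mul_prime hp.out (p / 2)
  have htors := eq_zero_of_prime_pow_smul_eq_zero_localFixedPointsOfEmb_kerSubgroup_of_quadraticTwist κ
    (closureEmb (K := ℚ) ℚ_[p]) hp2 W hc Cv hCV M hΔ hA hVM
  have hle : S0 ≤ A := by
    rw [hAdef, ← comap_layerToInfty_zero_strictSignedSelmerInfty_eq W κ ℚ_[p] (-1) S hS htors]
    intro y hy
    rw [AddSubgroup.mem_comap]
    exact map_layerToInfty_strictSignedSelmerLayer_le W κ ℚ_[p] (-1) 0 ⟨y, hy, rfl⟩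
  -- Lagrange: `#A₀ = [A₀ : S₀] · #S₀`
  have hcardS : Nat.card (S0.addSubgroupOf A) = Nat.card S0 :=
    Nat.card_congr (AddSubgroup.addSubgroupOfEquivOfLe hle).toEquiv
  have hmul : Nat.card A = Nat.card (A ⧸ S0.addSubgroupOf A) * Nat.card S0 := by
    rw [AddSubgroup.card_eq_card_quotient_mul_card_addSubgroup (S0.addSubgroupOf A), hcardS]
  have hrel : Nat.card (A ⧸ S0.addSubgroupOf A) = S0.relIndex A := rfl
  rw [hmul, hrel, hS0, hAdef, hC, StrictSignedLayerZero.natCard_strictSignedSelmerLayer_neg_one_zero_eq_strictSelmerPInfty W κ]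
  ring

end LevelBridge

end Summit.BirchSwinnertonDyer.Rank1Residual.Additive

end
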